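import Summits.NavierStokesRegularity.FluidComputer.LerayClock
import Summits.NavierStokesRegularity.FluidComputer.LeraySupClock
import Literature.Analysis.FluidPDE.KatoGlobalSmallHolds
import Literature.Analysis.FluidPDE.KatoLerayHopf
import Literature.Analysis.FluidPDE.MildL3SmoothHolds
import Literature.Analysis.FluidPDE.ClassicalEarlyWindowBound
import Literature.Analysis.FunctionSpaces.FourierSobolevNormEmbeddingProofs
import HarnessLib

/-!
# Fluid computer — the CRITICAL FACE of the level dictionary, II: KATO'S CRITICAL FLOOR (L28)

HONEST FRAMING (cell `pub-fluidc`, verbatim): *low prior, high value-of-information experiment on Tao's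
machine paradigm; NOT a claim that NS blows up.* Theorem side of the cell; nothing here is evidence of blow-up.
Companion of `CriticalDivergence` (L27: `‖u(t)‖_{L³} → ∞` as `t ↑ T`). That statement is asymptotic; this one
holds AT EVERY INSTANT of the open lifespan. For every maximal smooth solution `(u, p)` of the unforced
Navier–Stokes system on `ℝ³ × [0, T)` (`ν > 0`; classical on `[0, T)`, no smooth extension past `T`) which is
Leray–Hopf from `u 0`:

* `eLpNorm_three_floor` (**L28 — KATO'S CRITICAL FLOOR**): there is ONE absolute `δ > 0` (Kato's small-data
  constant, Kato 1984 Thms. 2 and 4) with `‖u(t)‖_{L³(ℝ³)} > δ ν` for EVERY `t ∈ (0, T)`. A realised blow-up is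
  NEVER critically small, at any instant of its life — not only near `T`. In the tree Kato's theorem is the
  discharged named fact `kato_global_small_holds` (a global mild solution in `C([0,∞); L³)` with the smoothing bound
  `‖v(s)‖_∞ ≤ C/√s`); the continuation step `hasSmoothExtensionPast_of_kato` turns it into an extension past `T`:
  the Kato solution `v` from `u(t₀)` is a Leray–Hopf weak solution on every `[0, T')`
  (`IsKatoSolutionOn.isLerayHopfOn_of_memLp_two`, Escauriaza–Seregin–Šverák 2003 Remark 7.5 / Kato Thm. 4, PROVED in
  the tree through Galdi's energy equality), the classical translate `u(· + t₀)` is Leray–Hopf from `u(t₀)` on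
  every window (`LerayClock.isLerayHopfOn_translate`) and BOUNDED there (`LeraySupClock.exists_bound_window`), hence
  in Serrin's class `L^∞_t L^∞_x`, so weak–strong uniqueness (`serrin_weak_strong_uniqueness_holds`, with the
  classical solution as the strong member) identifies `v = u(· + t₀)` below `T`; the classical representative of
  `v` on `(0, ∞)` (`mild_L3_smooth_holds`: Giga 1986 / Kato 1984, PROVED in the tree) then glues to `u` and
  continues it past `T` — absurd.
* `eHomSobolevSeminorm_half_floor` (**L28′ — the `Ḣ^{1/2}` floor**, Fujita–Kato's currency): an absolute `δ' > 0`
  with `‖u(t)‖_{Ḣ^{1/2}} > δ' ν` at every `t ∈ (0, T)` (L28 and the critical embedding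
  `‖f‖_{L³} ≤ C ‖f‖_{Ḣ^{1/2}}`, `eLpNorm_three_le_eHomSobolevSeminorm_half_holds`).

Reading. Both floors are SCALE-INVARIANT (`δ ν` is the only admissible shape: `u ↦ λu(λ²t, λx)` fixes `‖·‖_{L³}`
and `‖·‖_{Ḣ^{1/2}}`; `ν ↦` viscosity one by `u ↦ ν⁻¹u(ν⁻¹t, x)`). They are the common critical ancestor of the
dictionary's two scale-invariant PRODUCT floors: by `‖f‖_{L³}³ ≤ ‖f‖_∞ ‖f‖₂²` the floor L28 gives
`(δν)³ < ‖u(t)‖_∞ ‖u(t)‖₂²` (`LerayTimeFace.amplitude_energy_product_ge`, there from the sup clock × the deadline),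
and by `‖f‖_{L³} ≤ ‖f‖₂^{1/2} ‖f‖₆^{1/2} ≤ C ‖f‖₂^{1/2} ‖∇f‖₂^{1/2}` it gives `(δν)⁴ < C⁴ ‖u(t)‖₂² ∫|∇u(t)|²`
(`LerayDeadline.energy_enstrophy_product_ge`, there from the enstrophy clock × the deadline). The instant `t = 0`
is excluded exactly as for the sup clock L21 (the datum of the class need not be bounded). HONEST SIZE NOTE: `δ`
inexplicit (Kato's fixed-point constant); `δν ≈ 3.3·10⁻³ δ` at the cell's `ρ = 3` against `‖u₀‖_{L³}` of order
one for the designed fields — like every other floor it is read against WORDS ('never critically small'), not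
against a certified atlas number. Necessity only; nothing about sufficiency. 0 sorry; no new definitions, no named
facts.

## References

* T. Kato, *Strong `L^p`-solutions of the Navier–Stokes equation in `ℝ^m`, with applications to weak solutions*,
  Math. Z. 187 (1984) 471–480, Thms. 2 and 4. [Kato1984MathZ]
* L. Escauriaza, G. Seregin, V. Šverák, Russ. Math. Surveys 58:2 (2003), Thm. 7.4 and Remark 7.5.
  [EscauriazaSereginSverak2003]
* Y. Giga, J. Differential Equations 62 (1986) 186–212, Thm. 4. [Giga1986]
* P. G. Lemarié-Rieusset, *The Navier–Stokes Problem in the 21st Century*, CRC 2016, Thm. 7.5, Thm. 15.1.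
  [LemarieRieusset2016]
* H. Bahouri, J.-Y. Chemin, R. Danchin, *Fourier Analysis and Nonlinear PDE*, Springer 2011, Thm. 1.38.
  [BahouriCheminDanchin2011]
-/

noncomputable section

open MeasureTheory Set Function Filter Topology Metric
open scoped ENNReal NNReal
open Literature.Analysis.FluidPDE Literature.Analysis.FunctionSpaces
open Summit.NavierStokesRegularity.FluidComputer.LerayClock
open Summit.NavierStokesRegularity.FluidComputer.LeraySupClock

namespace Summit.NavierStokesRegularity.FluidComputer.CriticalFloor

/-! ## The continuation step: a global Kato solution from an interior slice extends `u` past `T` -/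

/-- **The continuation step of the critical floor** (Kato 1984, Thm. 4 with Escauriaza–Seregin–Šverák 2003,
Remark 7.5; Giga 1986, Thm. 4; Prodi–Serrin weak–strong uniqueness). Let `(u, p)` be a classical solution of the
unforced Navier–Stokes system on `ℝ³ × [0, T)` (`ν > 0`), Leray–Hopf from `u 0`, and `t₀ ∈ (0, T)`. Suppose the
slice `u(t₀)` launches a GLOBAL Kato solution `v` (mild, `v ∈ C([0,∞); L³)`, `v(0) = u(t₀)`, measurable) with
Kato's smoothing bound `‖v(s)‖_∞ ≤ C/√s`. Then `u` extends classically past `T`. Proof: `v` is Leray–Hopf on every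
`[0, T')` from `u(t₀) ∈ L²` (`IsKatoSolutionOn.isLerayHopfOn_of_memLp_two`); the translate `u(· + t₀)` is
Leray–Hopf from `u(t₀)` on every window `[0, T₂ − t₀)`, `T₂ < T` (`LerayClock.isLerayHopfOn_translate`), and
bounded there (`LeraySupClock.exists_bound_window`), i.e. in Serrin's class `L^∞_t L^∞_x`, so `v = u(· + t₀)`
a.e. at every time below `T − t₀` (`serrin_weak_strong_uniqueness_holds`); the classical representative `(w, π)`
of `v` on `(0, ∞)` (`mild_L3_smooth_holds`) agrees with `u(· + t₀)` everywhere on `(0, T − t₀)` by continuity and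
glues to `u` along `(t₀, T)` (`IsClassicalNSSolutionOn.glue`), a classical solution on `[0, T + 1)`.
[cite: Kato1984MathZ, Thm. 4] [cite: EscauriazaSereginSverak2003, Thm. 7.4 with Remark 7.5]
[cite: Giga1986, Thm. 4] -/
theorem hasSmoothExtensionPast_of_kato {ν T : ℝ} (hν : 0 < ν) (hT : 0 < T)
    {u : ℝ → EuclideanSpace ℝ (Fin 3) → EuclideanSpace ℝ (Fin 3)} {p : ℝ → EuclideanSpace ℝ (Fin 3) → ℝ}
    (hcl : IsClassicalNSSolutionOn (Ico 0 T) ν 0 u p) (hLH : IsLerayHopfOn T ν 0 (u 0) u)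
    {t₀ : ℝ} (ht₀ : t₀ ∈ Ioo 0 T)
    {v : ℝ → EuclideanSpace ℝ (Fin 3) → EuclideanSpace ℝ (Fin 3)}
    (hv : IsGlobalMildSolution ν 0 (u t₀) v) (hvc : ContinuousInLpOn (Ici 0) 3 v) (hv0 : v 0 = u t₀)
    (hvm : AEStronglyMeasurable (uncurry v) (volume.restrict (Ioi 0 ×ˢ univ)))
    {C : ℝ} (hinf : ∀ s : ℝ, 0 < s → eLpNorm (v s) ∞ volume ≤ ENNReal.ofReal (C / Real.sqrt s)) :
    HasSmoothExtensionPast ν 0 u T := by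
  -- the Kato solution on `[0, T₀)`, `T₀ = T - t₀ + 1`
  set T₀ : ℝ := T - t₀ + 1 with hT₀
  have hT₀pos : 0 < T₀ := by rw [hT₀]; linarith [ht₀.2]
  have hK : IsKatoSolutionOn T₀ ν (u t₀) v :=
    ⟨hv.mono Ico_subset_Ici_self, hvc.mono Ico_subset_Ici_self, hv0,
      hvm.mono_measure (Measure.restrict_mono (prod_mono Ioo_subset_Ioi_self subset_rfl) le_rfl)⟩
  have hinf' : ∀ s ∈ Ioo 0 T₀, eLpNorm (v s) ∞ volume ≤ ENNReal.ofReal (C / Real.sqrt s) :=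
    fun s hs => hinf s hs.1
  -- the datum `u t₀ ∈ L² ∩ L³`, weakly divergence free
  have hu2 : MemLp (u t₀) 2 volume := hLH.memLp t₀ ⟨ht₀.1.le, ht₀.2.le⟩
  have hu3 : MemLp (u t₀) 3 volume := hK.memLp_initial hT₀pos
  have hrestart : ∀ T₂ ∈ Ioo t₀ T, IsLerayHopfOn (T₂ - t₀) ν 0 (u t₀) (fun s => u (s + t₀)) :=
    fun T₂ hT₂ => isLerayHopfOn_translate hν hT hcl hLH ht₀ hT₂
  have hdiv : IsWeaklyDivFree (u t₀) := hK.isWeaklyDivFree_initial hT₀pos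
  -- the classical representative `(w, π)` of `v` on `(0, T₀)`
  obtain ⟨w, π, hwπ, hwv⟩ := mild_L3_smooth_holds hν hT₀pos hu3 hdiv hK.mild hK.continuousInLpOn
    hK.aestronglyMeasurable
  -- everywhere agreement `u t' = w (t' - t₀)` on `(t₀, T)`
  have heq : ∀ t' ∈ Ioo t₀ T, u t' = w (t' + -t₀) := by
    intro t' ht'
    -- a window `[0, T')`, `T' = T₂ - t₀`, `t' < T₂ < T`
    have hT₂ : (t' + T) / 2 ∈ Ioo t₀ T := ⟨by linarith [ht'.1, ht'.2], by linarith [ht'.2]⟩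
    set T' : ℝ := (t' + T) / 2 - t₀ with hT'
    have hT'pos : 0 < T' := by rw [hT']; linarith [hT₂.1]
    have hT'T₀ : T' < T₀ := by rw [hT', hT₀]; linarith [hT₂.2]
    -- the translate is Leray–Hopf on `[0, T')` and bounded there: Serrin's class `L^∞ L^∞`
    have hLHu : IsLerayHopfOn T' ν 0 (u t₀) (fun s => u (s + t₀)) := hrestart _ hT₂
    obtain ⟨M, hM⟩ := exists_bound_window hν hT hcl hLH ht₀.1 (T' := (t' + T) / 2) hT₂.2
    have hS : MemLqLp ∞ ∞ (fun s => u (s + t₀)) (Ioo 0 T') :=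
      memLqLp_top_top_of_bound (fun s hs => (hLHu.memLp s hs).1)
        (fun s hs x => hM (s + t₀) ⟨by linarith [hs.1], by rw [hT'] at hs; linarith [hs.2]⟩ x)
    -- the Kato solution is Leray–Hopf on `[0, T')`
    have hLHv : IsLerayHopfOn T' ν 0 (u t₀) v := (hK.isLerayHopfOn_of_memLp_two hν hu2 hinf' hT'T₀ hT'pos).1
    -- weak–strong uniqueness, the classical translate being the strong solution
    have hae : ∀ s ∈ Ioc 0 T', v s =ᵐ[volume] (fun s => u (s + t₀)) s :=
      serrin_weak_strong_uniqueness_holds hν hT'pos hLHu hu2 (q := ∞) (r := ∞) (by simp) (by simp) hS hLHv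
    have hts : t' - t₀ ∈ Ioc 0 T' := ⟨sub_pos.2 ht'.1, by rw [hT']; linarith [hT₂.1, ht'.2]⟩
    have h1 : v (t' - t₀) =ᵐ[volume] u t' := by
      have h := hae (t' - t₀) hts
      simpa only [sub_add_cancel] using h
    have h2 : w (t' - t₀) =ᵐ[volume] v (t' - t₀) := hwv (t' - t₀) ⟨hts.1, hts.2.trans_lt hT'T₀⟩
    have hcu : Continuous (u t') := (hcl.contDiff_velocity ⟨ht₀.1.le.trans ht'.1.le, ht'.2⟩).continuous
    have hcw : Continuous (w (t' - t₀)) := (hwπ.contDiff_velocity ⟨hts.1, hts.2.trans_lt hT'T₀⟩).continuous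
    rw [← sub_eq_add_neg]
    exact (Continuous.ae_eq_iff_eq volume hcu hcw).1 (h2.trans h1).symm
  -- the continuation piece `(w, π)(· - t₀)` on `(t₀, t₀ + T₀)`
  have h₂ : IsClassicalNSSolutionOn (Ioo t₀ (t₀ + T₀)) ν 0 (fun s => w (s + -t₀)) (fun s => π (s + -t₀)) := by
    have hwπ' := hwπ.comp_add_right (-t₀)
    have h0 : (fun s => (0 : ℝ → EuclideanSpace ℝ (Fin 3) → EuclideanSpace ℝ (Fin 3)) (s + -t₀)) = 0 := rfl
    rw [h0] at hwπ'
    exact hwπ'.mono (fun s hs => ⟨by simp only [mem_Ioo] at hs ⊢; linarith [hs.1],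
      by simp only [mem_Ioo] at hs ⊢; linarith [hs.2]⟩) isOpen_Ioo.uniqueDiffOn
  have hTT₀ : T < t₀ + T₀ := by rw [hT₀]; linarith
  -- glue along the overlap `(t₀, T)`
  exact ⟨t₀ + T₀, hTT₀, _, _, hcl.glue h₂ ht₀.1.le ht₀.2 hTT₀.le heq, fun s hs => by simp only [if_pos hs.2]⟩

/-! ## L28: Kato's critical floor at every instant -/

/-- **L28 — KATO'S CRITICAL FLOOR.** There is an absolute constant `δ > 0` such that for every `ν > 0`, `T > 0`
and every maximal smooth solution `(u, p)` of the unforced Navier–Stokes system on `ℝ³ × [0, T)` which is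
Leray–Hopf from `u 0`, at EVERY instant `t ∈ (0, T)`: `δ ν < ‖u(t)‖_{L³(ℝ³)}` (in `[0, ∞]`). `δ` is Kato's
small-data constant (`kato_global_small_holds`, Kato 1984 Thm. 2): were `‖u(t)‖_{L³} ≤ δ ν` at some interior
instant — `u(t)` being an `L³` field (bounded, `LeraySupClock.exists_bound_window`, and in `L²`) and weakly
divergence free — Kato's global solution from `u(t)` would extend `u` past `T` (`hasSmoothExtensionPast_of_kato`),
contradicting maximality. Scale-invariant; necessity at every instant of the open lifespan.
[cite: Kato1984MathZ, Thms. 2 and 4] [cite: LemarieRieusset2016, Thm. 7.5 and Thm. 15.1] -/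
theorem eLpNorm_three_floor :
    ∃ δ : ℝ, 0 < δ ∧ ∀ (ν T : ℝ), 0 < ν → 0 < T →
      ∀ (u : ℝ → EuclideanSpace ℝ (Fin 3) → EuclideanSpace ℝ (Fin 3)) (p : ℝ → EuclideanSpace ℝ (Fin 3) → ℝ),
      IsMaximalSmoothSolution ν 0 u p T → IsLerayHopfOn T ν 0 (u 0) u →
      ∀ t ∈ Ioo 0 T, ENNReal.ofReal (δ * ν) < eLpNorm (u t) 3 volume := by
  obtain ⟨δ, hδ, H⟩ := kato_global_small_holds
  refine ⟨δ, hδ, fun ν T hν hT u p hmax hLH t ht => ?_⟩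
  by_contra hle
  rw [not_lt] at hle
  -- the slice `u t ∈ L² ∩ L^∞ ⊂ L³`, weakly divergence free
  obtain ⟨M, hM⟩ := exists_bound_window hν hT hmax.1 hLH ht.1 (T' := t) ht.2
  have hu3 : MemLp (u t) 3 volume :=
    memLp_three_of_memLp_two_of_norm_le (hLH.memLp t ⟨ht.1.le, ht.2.le⟩) (fun x => hM t ⟨le_rfl, le_rfl⟩ x)
  have hT₂ : (t + T) / 2 ∈ Ioo t T := ⟨by linarith [ht.2], by linarith [ht.2]⟩
  have hdiv : IsWeaklyDivFree (u t) :=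
    (isLerayHopfOn_translate hν hT hmax.1 hLH ht hT₂).isWeaklyDivFree_datum (by linarith [hT₂.1])
  -- Kato's global solution from `u t`, with the smoothing bound `‖v(s)‖_∞ ≤ C s^{-1/2} = C/√s`
  obtain ⟨v, hv, hvc, hv0, hvm, ⟨C, hC⟩, -⟩ := H ν hν (u t) hu3 hdiv hle
  have hinf : ∀ s : ℝ, 0 < s → eLpNorm (v s) ∞ volume ≤ ENNReal.ofReal (C / Real.sqrt s) := by
    intro s hs
    have h := hC s hs
    have e : C * s ^ (-(1 / 2 : ℝ)) = C / Real.sqrt s := by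
      rw [Real.rpow_neg hs.le, Real.sqrt_eq_rpow, ← div_eq_mul_inv]
    rwa [e] at h
  exact hmax.2 (hasSmoothExtensionPast_of_kato hν hT hmax.1 hLH ht hv hvc hv0 hvm hinf)

/-! ## L28′: the floor in Fujita–Kato's currency -/

/-- **L28′ — THE `Ḣ^{1/2}` FLOOR.** There is an absolute `δ' > 0` such that along every maximal smooth Leray–Hopf
solution of the unforced system (`ν > 0`), at EVERY `t ∈ (0, T)`: `δ' ν < ‖u(t)‖_{Ḣ^{1/2}}` (the tree's
`Function.eHomSobolevSeminorm (1/2)` of the complexified slice — the `Ḣ^{1/2} ∩ L²` seminorm of ns.S14; it is `∞`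
off `Ḣ^{1/2}`, where the floor is trivial). With Kato's `δ` (L28) and the critical embedding constant `C`
(`‖f‖_{L³} ≤ C ‖f‖_{Ḣ^{1/2}}` for `L²` fields, `eLpNorm_three_le_eHomSobolevSeminorm_half_holds`, through the
isometry `complexify`): `δ' = δ/(C + 1)`. Scale-invariant; necessity at every instant.
[cite: BahouriCheminDanchin2011, Thm. 1.38] [cite: Kato1984MathZ, Thms. 2 and 4] -/
theorem eHomSobolevSeminorm_half_floor :
    ∃ δ' : ℝ, 0 < δ' ∧ ∀ (ν T : ℝ), 0 < ν → 0 < T →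
      ∀ (u : ℝ → EuclideanSpace ℝ (Fin 3) → EuclideanSpace ℝ (Fin 3)) (p : ℝ → EuclideanSpace ℝ (Fin 3) → ℝ),
      IsMaximalSmoothSolution ν 0 u p T → IsLerayHopfOn T ν 0 (u 0) u →
      ∀ t ∈ Ioo 0 T, ENNReal.ofReal (δ' * ν) <
        Function.eHomSobolevSeminorm (1 / 2 : ℝ) (EuclideanSpace.complexify ∘ u t) := by
  obtain ⟨δ, hδ, H⟩ := eLpNorm_three_floor
  obtain ⟨C, hC⟩ := @Literature.Analysis.FunctionSpaces.eLpNorm_three_le_eHomSobolevSeminorm_half_holds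
    (EuclideanSpace ℂ (Fin 3)) _ _ _
  have hC1 : (0 : ℝ) < C + 1 := by positivity
  refine ⟨δ / (C + 1), div_pos hδ hC1, fun ν T hν hT u p hmax hLH t ht => ?_⟩
  have hfloor := H ν T hν hT u p hmax hLH t ht
  set S : ℝ≥0∞ := Function.eHomSobolevSeminorm (1 / 2 : ℝ) (EuclideanSpace.complexify ∘ u t) with hS
  -- the embedding on the slice: `‖u(t)‖₃ ≤ C S ≤ (C + 1) S`
  have h2 : MemLp (EuclideanSpace.complexify ∘ u t) 2 volume :=
    memLp_complexify_comp (hLH.memLp t ⟨ht.1.le, ht.2.le⟩)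
  have hnorm : eLpNorm (u t) 3 volume = eLpNorm (EuclideanSpace.complexify ∘ u t) 3 volume :=
    eLpNorm_congr_norm_ae (Eventually.of_forall fun x => (EuclideanSpace.norm_complexify (u t x)).symm)
  have hemb : eLpNorm (u t) 3 volume ≤ ((C + 1 : ℝ≥0) : ℝ≥0∞) * S := by
    rw [hnorm]
    refine (hC _ h2).trans (mul_le_mul' ?_ le_rfl)
    exact_mod_cast le_add_of_nonneg_right zero_le_one
  -- so `δ ν < (C + 1) S`, i.e. `δ ν / (C + 1) < S`
  have hlt : ENNReal.ofReal (δ * ν) < ((C + 1 : ℝ≥0) : ℝ≥0∞) * S := hfloor.trans_le hemb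
  have hC1' : ((C + 1 : ℝ≥0) : ℝ≥0∞) ≠ 0 := by exact_mod_cast hC1.ne'
  have hC1top : ((C + 1 : ℝ≥0) : ℝ≥0∞) ≠ ⊤ := ENNReal.coe_ne_top
  have hdiv : ENNReal.ofReal (δ / (C + 1) * ν) = ENNReal.ofReal (δ * ν) / ((C + 1 : ℝ≥0) : ℝ≥0∞) := by
    rw [div_mul_eq_mul_div, ENNReal.ofReal_div_of_pos hC1]
    congr 1
    rw [ENNReal.ofReal_add (NNReal.coe_nonneg C) zero_le_one, ENNReal.ofReal_coe_nnreal, ENNReal.ofReal_one]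
    push_cast
    rfl
  rw [hdiv, ENNReal.div_lt_iff (Or.inl hC1') (Or.inl hC1top)]
  exact hlt.trans_eq (mul_comm _ _)

end Summit.NavierStokesRegularity.FluidComputer.CriticalFloor

end
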